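import Literature.NumberTheory.Automorphic.PadicPlaceCoefficientRingFinite
import Mathlib.RingTheory.DiscreteValuationRing.TFAE
import Mathlib.LinearAlgebra.FreeModule.PID
import HarnessLib

/-!
# The unit ball `𝒪_E = {x ∈ E : |x| ≤ 1}` of a finite extension `E/ℚ_p` inside `ℚ̄_p`:
# a complete discrete valuation ring, finite free over `ℤ_p` and over smaller unit balls

Topic `NumberTheory/Automorphic`; namespace `Literature.NumberTheory.Automorphic` (grouping
sub-namespace `PadicIntermediateField`).  One definition with a body (`unitBall`), instances stating
its algebraic structure, and theorems; no named fact, no `sorry`.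

`PadicPlaceCoefficientRingFinite` proves, for the CHOSEN coefficient field `coeffField K p`, that
its unit ball `coeffRing K p` is the integral closure of `ℤ_p`, finite free over `ℤ_p` and
Noetherian.  The passage from a Noetherian coefficient ring to `ℤ̄_p` in [Scholze2015, §V.4]
(`ℤ̄_p = ⋃_{E'} 𝒪_{E'}`; adjoining Hecke eigenvalues, `Algebra/Module/EigenvalueLattice`) needs the
same for EVERY finite `E' ⊂ ℚ̄_p`, and a little more.  For `E : IntermediateField ℚ_[p] ℚ̄_p`
finite-dimensional:

* `unitBall p E = E ∩ ℤ̄_p`, a subring of `ℚ̄_p`; it is the integral closure of `ℤ_p` in `E`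
  (`isIntegralClosure_unitBall`, via `isIntegral_padicInt_iff_norm_le_one`), hence
  `Module.Finite ℤ_[p]`, `Module.Free ℤ_[p]`, `IsNoetherianRing`, `IsDedekindDomain`
  (Mathlib `IsIntegralClosure.finite / module_free / isNoetherianRing / isDedekindDomain`);
* it is LOCAL (the non-units are `{|x| < 1}`), hence a principal ideal domain
  (Mathlib `IsDedekindDomain.isPrincipalIdealRing`), with `p` in the maximal ideal; divisibility is
  total (`dvd_total`); `p^t` is PURE in `𝒪_E ⊂ ℤ̄_p` (`pow_prime_dvd_of_dvd_valuationSubring`);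
* for `E₀ ≤ E`: `𝒪_E` is a finite free `𝒪_{E₀}`-module (`moduleFinite_unitBall_of_le`,
  `moduleFree_unitBall_of_le`).

[NeukirchANT1999, Ch. II (4.8), (6.8), §8]; Serre, *Local Fields*, II §2 Prop. 3.

## References

* J. Neukirch, *Algebraic Number Theory* (1999), Ch. II (4.8), (6.8). [NeukirchANT1999]
* P. Scholze, Ann. of Math. 182 (2015), §V.4. [Scholze2015]
-/

noncomputable section

namespace Literature.NumberTheory.Automorphic

namespace PadicIntermediateField

open ParallelWeight

variable (p : ℕ) [Fact p.Prime] (E : IntermediateField ℚ_[p] (PadicAlgCl p))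

/-! ### The unit ball -/

/-- **The unit ball `𝒪_E = {x ∈ E : |x| ≤ 1} = E ∩ ℤ̄_p`** of an intermediate field `E` of
`ℚ̄_p / ℚ_p`, as a subring of `ℚ̄_p`. [cite: NeukirchANT1999, Ch. II §4 (4.8)] -/
def unitBall : Subring (PadicAlgCl p) :=
  E.toSubring ⊓ (Valued.v : Valuation (PadicAlgCl p) NNReal).valuationSubring.toSubring

/-- Membership in `𝒪_E`. [folklore] -/
theorem mem_unitBall_iff {x : PadicAlgCl p} : x ∈ unitBall p E ↔ x ∈ E ∧ Valued.v x ≤ 1 := by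
  rw [unitBall, Subring.mem_inf]
  exact Iff.rfl

/-- `𝒪_E ⊆ ℤ̄_p`. [folklore] -/
theorem valued_le_one_of_mem_unitBall {x : PadicAlgCl p} (hx : x ∈ unitBall p E) : Valued.v x ≤ 1 :=
  ((mem_unitBall_iff p E).1 hx).2

/-- `𝒪_E ⊆ E`. [folklore] -/
theorem mem_of_mem_unitBall {x : PadicAlgCl p} (hx : x ∈ unitBall p E) : x ∈ E :=
  ((mem_unitBall_iff p E).1 hx).1

/-- `𝒪_E ≤ ℤ̄_p` as subrings. [folklore] -/
theorem unitBall_le_valuationSubring :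
    unitBall p E ≤ (Valued.v : Valuation (PadicAlgCl p) NNReal).valuationSubring.toSubring :=
  inf_le_right

/-- `ℤ_p → 𝒪_E`. [folklore] -/
theorem algebraMap_padicInt_mem_unitBall (z : ℤ_[p]) :
    algebraMap ℤ_[p] (PadicAlgCl p) z ∈ unitBall p E := by
  rw [mem_unitBall_iff]
  refine ⟨?_, ?_⟩
  · rw [IsScalarTower.algebraMap_apply ℤ_[p] ℚ_[p] (PadicAlgCl p)]
    exact E.algebraMap_mem _
  · rw [PadicAlgCl.valuation_def, ← NNReal.coe_le_coe, coe_nnnorm, NNReal.coe_one]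
    exact norm_algebraMap_padicInt_le_one p z

/-- The coefficient ring of `PadicPlaceCoefficientRing` is the unit ball of the coefficient field.
[folklore] -/
theorem coeffRing_eq_unitBall (K : Type) [Field K] [NumberField K] :
    coeffRing K p = unitBall p (coeffField K p) :=
  rfl

/-! ### Algebra structure -/

/-- `𝒪_E` as a `ℤ_p`-algebra. [folklore] -/
instance algebraPadicInt : Algebra ℤ_[p] (unitBall p E) :=
  ((algebraMap ℤ_[p] (PadicAlgCl p)).codRestrict (unitBall p E)
    (algebraMap_padicInt_mem_unitBall p E)).toAlgebra

/-- `𝒪_E ⊆ E` as an algebra. [folklore] -/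
instance algebraField : Algebra (unitBall p E) E :=
  (Subring.inclusion (inf_le_left : unitBall p E ≤ E.toSubring)).toAlgebra

/-- `algebraMap 𝒪_E E` is the inclusion. [folklore] -/
theorem coe_algebraMap_unitBall (y : unitBall p E) :
    ((algebraMap (unitBall p E) E y : E) : PadicAlgCl p) = y :=
  rfl

/-- `ℤ_p → E` is injective. [folklore] -/
instance faithfulSMul_field : FaithfulSMul ℤ_[p] E :=
  (faithfulSMul_iff_algebraMap_injective ℤ_[p] E).2 (by
    intro a b h
    have h' : algebraMap ℚ_[p] E (algebraMap ℤ_[p] ℚ_[p] a) =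
        algebraMap ℚ_[p] E (algebraMap ℤ_[p] ℚ_[p] b) := by
      rw [← IsScalarTower.algebraMap_apply, ← IsScalarTower.algebraMap_apply]; exact h
    exact IsFractionRing.injective ℤ_[p] ℚ_[p] ((algebraMap ℚ_[p] E).injective h'))

/-- `ℤ_p → 𝒪_E → E` commutes. [folklore] -/
instance isScalarTower_field : IsScalarTower ℤ_[p] (unitBall p E) E :=
  IsScalarTower.of_algebraMap_eq fun z => Subtype.ext (by
    change algebraMap ℤ_[p] (PadicAlgCl p) z = _
    rw [IsScalarTower.algebraMap_apply ℤ_[p] ℚ_[p] (PadicAlgCl p)]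
    rfl)

/-- `ℤ_p → 𝒪_E → ℚ̄_p` commutes. [folklore] -/
instance isScalarTower_padicAlgCl : IsScalarTower ℤ_[p] (unitBall p E) (PadicAlgCl p) :=
  IsScalarTower.of_algebraMap_eq fun _ => rfl

/-- Integrality over `ℤ_p` of an element of `E` is integrality in `ℚ̄_p`. [folklore] -/
theorem isIntegral_field_iff (x : E) : IsIntegral ℤ_[p] x ↔ IsIntegral ℤ_[p] (x : PadicAlgCl p) := by
  have h : Function.Injective (E.val.restrictScalars ℤ_[p]) := Subtype.val_injective
  exact (isIntegral_algHom_iff _ h).symm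

/-- **`𝒪_E` is the integral closure of `ℤ_p` in `E`.** [cite: NeukirchANT1999, Ch. II (6.2) and §8] -/
instance isIntegralClosure_unitBall : IsIntegralClosure (unitBall p E) ℤ_[p] E where
  algebraMap_injective := fun a b h => Subtype.ext (by
    have := congrArg (fun y : E => (y : PadicAlgCl p)) h
    exact this)
  isIntegral_iff := fun {x} => by
    rw [isIntegral_field_iff, isIntegral_padicInt_iff_norm_le_one]
    constructor
    · intro hx
      refine ⟨⟨(x : PadicAlgCl p), (mem_unitBall_iff p E).2 ⟨x.2, ?_⟩⟩, Subtype.ext rfl⟩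
      rw [PadicAlgCl.valuation_def, ← NNReal.coe_le_coe, coe_nnnorm, NNReal.coe_one]
      exact hx
    · rintro ⟨y, rfl⟩
      have hy := valued_le_one_of_mem_unitBall p E y.2
      rw [PadicAlgCl.valuation_def, ← NNReal.coe_le_coe, coe_nnnorm, NNReal.coe_one] at hy
      exact hy

/-! ### Finiteness over `ℤ_p`, Dedekind, local, principal -/

variable [FiniteDimensional ℚ_[p] E]

/-- **`𝒪_E` is a finitely generated `ℤ_p`-module.** [cite: NeukirchANT1999, Ch. II (6.8) with (4.8)] -/
instance moduleFinite_unitBall : Module.Finite ℤ_[p] (unitBall p E) :=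
  IsIntegralClosure.finite ℤ_[p] ℚ_[p] E (unitBall p E)

/-- **`𝒪_E` is Noetherian.** [folklore] -/
instance isNoetherianRing_unitBall : IsNoetherianRing (unitBall p E) :=
  IsIntegralClosure.isNoetherianRing ℤ_[p] ℚ_[p] E (unitBall p E)

/-- **`𝒪_E` is a free `ℤ_p`-module.** [cite: NeukirchANT1999, Ch. II (6.8)] -/
instance moduleFree_unitBall : Module.Free ℤ_[p] (unitBall p E) :=
  IsIntegralClosure.module_free ℤ_[p] ℚ_[p] E (unitBall p E)

/-- **`𝒪_E` is a Dedekind domain** (integral closure of `ℤ_p` in a finite extension).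
[cite: NeukirchANT1999, Ch. I (8.1), Ch. II §8] -/
instance isDedekindDomain_unitBall : IsDedekindDomain (unitBall p E) :=
  IsIntegralClosure.isDedekindDomain ℤ_[p] ℚ_[p] E (unitBall p E)

omit [FiniteDimensional ℚ_[p] E] in
/-- Units of `𝒪_E` have valuation `1`. [folklore] -/
theorem valued_eq_one_of_isUnit {x : unitBall p E} (hx : IsUnit x) : Valued.v (x : PadicAlgCl p) = 1 := by
  obtain ⟨u, rfl⟩ := hx
  apply le_antisymm (valued_le_one_of_mem_unitBall p E u.1.2)
  have h1 : Valued.v ((u : unitBall p E) : PadicAlgCl p) *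
      Valued.v ((↑(u⁻¹) : unitBall p E) : PadicAlgCl p) = 1 := by
    rw [← map_mul, ← Subring.coe_mul, Units.mul_inv, Subring.coe_one, map_one]
  have h2 := valued_le_one_of_mem_unitBall p E (↑(u⁻¹) : unitBall p E).2
  by_contra h
  push Not at h
  have : Valued.v ((u : unitBall p E) : PadicAlgCl p) *
      Valued.v ((↑(u⁻¹) : unitBall p E) : PadicAlgCl p) < 1 * 1 :=
    mul_lt_mul_of_lt_of_le_of_nonneg_of_pos h h2 zero_le zero_lt_one
  rw [h1, one_mul] at this
  exact lt_irrefl _ this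

omit [FiniteDimensional ℚ_[p] E] in
/-- Elements of `𝒪_E` of valuation `1` are units. [folklore] -/
theorem isUnit_of_valued_eq_one {x : unitBall p E} (hx : Valued.v (x : PadicAlgCl p) = 1) : IsUnit x := by
  have hx0 : (x : PadicAlgCl p) ≠ 0 := by
    intro h; rw [h, map_zero] at hx; exact zero_ne_one hx
  have hinv : (x : PadicAlgCl p)⁻¹ ∈ unitBall p E := by
    rw [mem_unitBall_iff]
    refine ⟨?_, ?_⟩
    · exact E.inv_mem (mem_of_mem_unitBall p E x.2)
    · rw [map_inv₀, hx, inv_one]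
  refine ⟨⟨x, ⟨_, hinv⟩, Subtype.ext (mul_inv_cancel₀ hx0), Subtype.ext (inv_mul_cancel₀ hx0)⟩, rfl⟩

omit [FiniteDimensional ℚ_[p] E] in
/-- **`𝒪_E` is a local ring**: the non-units `{|x| < 1}` are closed under addition. [folklore] -/
instance isLocalRing_unitBall : IsLocalRing (unitBall p E) := by
  refine IsLocalRing.of_nonunits_add fun a b ha hb hab => ?_
  have hva : Valued.v (a : PadicAlgCl p) < 1 :=
    lt_of_le_of_ne (valued_le_one_of_mem_unitBall p E a.2) fun h => ha (isUnit_of_valued_eq_one p E h)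
  have hvb : Valued.v (b : PadicAlgCl p) < 1 :=
    lt_of_le_of_ne (valued_le_one_of_mem_unitBall p E b.2) fun h => hb (isUnit_of_valued_eq_one p E h)
  have h1 := valued_eq_one_of_isUnit p E hab
  rw [Subring.coe_add] at h1
  have h2 := Valuation.map_add_lt (Valued.v : Valuation (PadicAlgCl p) NNReal) hva hvb
  rw [h1] at h2
  exact lt_irrefl _ h2

/-- **`𝒪_E` is a principal ideal domain** (a local Dedekind domain). [folklore] -/
theorem isPrincipalIdealRing_unitBall : IsPrincipalIdealRing (unitBall p E) := inferInstance

omit [FiniteDimensional ℚ_[p] E] in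
/-- `p` is not a unit of `𝒪_E`. [folklore] -/
theorem not_isUnit_natCast_prime : ¬ IsUnit ((p : ℕ) : unitBall p E) := by
  intro h
  have h1 := valued_eq_one_of_isUnit p E h
  rw [Subring.coe_natCast, PadicAlgCl.valuation_p, one_div, inv_eq_one] at h1
  have hp : (1 : NNReal) < p := by exact_mod_cast (Fact.out : p.Prime).one_lt
  exact (ne_of_gt hp) h1

omit [FiniteDimensional ℚ_[p] E] in
/-- `p` lies in the maximal ideal of `𝒪_E`. [folklore] -/
theorem natCast_prime_mem_maximalIdeal : ((p : ℕ) : unitBall p E) ∈ IsLocalRing.maximalIdeal (unitBall p E) :=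
  (IsLocalRing.mem_maximalIdeal _).2 (not_isUnit_natCast_prime p E)

omit [FiniteDimensional ℚ_[p] E] in
/-- `p ≠ 0` in `𝒪_E`. [folklore] -/
theorem natCast_prime_ne_zero : ((p : ℕ) : unitBall p E) ≠ 0 := by
  intro h
  have h' := congrArg (fun x : unitBall p E => (x : PadicAlgCl p)) h
  simp only [Subring.coe_natCast, ZeroMemClass.coe_zero, Nat.cast_eq_zero] at h'
  exact (Fact.out : p.Prime).ne_zero h'

omit [FiniteDimensional ℚ_[p] E] in
/-- **Divisibility in `𝒪_E` is total** (it is a valuation ring of `E`). [folklore] -/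
theorem dvd_total (a b : unitBall p E) : a ∣ b ∨ b ∣ a := by
  rcases le_total (Valued.v (b : PadicAlgCl p)) (Valued.v (a : PadicAlgCl p)) with h | h
  · by_cases ha : (a : PadicAlgCl p) = 0
    · have hb : (b : PadicAlgCl p) = 0 := by
        rw [ha, map_zero] at h; exact (map_eq_zero _).1 (le_antisymm h zero_le)
      refine Or.inl ⟨0, Subtype.ext ?_⟩
      rw [Subring.coe_mul, hb, ZeroMemClass.coe_zero, mul_zero]
    · refine Or.inl ⟨⟨(b : PadicAlgCl p) / a, (mem_unitBall_iff p E).2 ⟨?_, ?_⟩⟩, Subtype.ext ?_⟩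
      · exact div_mem (mem_of_mem_unitBall p E b.2) (mem_of_mem_unitBall p E a.2)
      · rw [map_div₀]; exact div_le_one_of_le₀ h zero_le
      · rw [Subring.coe_mul]; exact (mul_div_cancel₀ _ ha).symm
  · by_cases hb : (b : PadicAlgCl p) = 0
    · have ha : (a : PadicAlgCl p) = 0 := by
        rw [hb, map_zero] at h; exact (map_eq_zero _).1 (le_antisymm h zero_le)
      refine Or.inr ⟨0, Subtype.ext ?_⟩
      rw [Subring.coe_mul, ha, ZeroMemClass.coe_zero, mul_zero]
    · refine Or.inr ⟨⟨(a : PadicAlgCl p) / b, (mem_unitBall_iff p E).2 ⟨?_, ?_⟩⟩, Subtype.ext ?_⟩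
      · exact div_mem (mem_of_mem_unitBall p E a.2) (mem_of_mem_unitBall p E b.2)
      · rw [map_div₀]; exact div_le_one_of_le₀ h zero_le
      · rw [Subring.coe_mul]; exact (mul_div_cancel₀ _ hb).symm

omit [FiniteDimensional ℚ_[p] E] in
/-- **`p^t` is pure in `𝒪_E ⊂ ℤ̄_p`**: if `x ∈ 𝒪_E` is divisible by `p^t` in `ℤ̄_p` (i.e.
`|x| ≤ |p|^t`), it is divisible by `p^t` in `𝒪_E`. [folklore] -/
theorem pow_prime_dvd_of_valued_le (t : ℕ) {x : unitBall p E}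
    (hx : Valued.v (x : PadicAlgCl p) ≤ Valued.v ((p : PadicAlgCl p) ^ t)) :
    ((p : ℕ) : unitBall p E) ^ t ∣ x := by
  have hp0 : ((p : PadicAlgCl p)) ^ t ≠ 0 :=
    pow_ne_zero _ (Nat.cast_ne_zero.2 (Fact.out : p.Prime).ne_zero)
  refine ⟨⟨(x : PadicAlgCl p) / (p : PadicAlgCl p) ^ t, (mem_unitBall_iff p E).2 ⟨?_, ?_⟩⟩,
    Subtype.ext ?_⟩
  · exact div_mem (mem_of_mem_unitBall p E x.2) (pow_mem (E.natCast_mem p) t)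
  · rw [map_div₀]; exact div_le_one_of_le₀ hx zero_le
  · rw [Subring.coe_mul, Subring.coe_pow, Subring.coe_natCast]
    exact (mul_div_cancel₀ _ hp0).symm

omit [FiniteDimensional ℚ_[p] E] in
/-- Purity in the form consumed by `exists_retraction_quotient_algebraMap`: if `x ∈ 𝒪_E` is a
multiple of `p^t` in the valuation ring `ℤ̄_p`, then `p^t ∣ x` in `𝒪_E`. [folklore] -/
theorem pow_prime_dvd_of_dvd_valuationSubring (t : ℕ) {x : unitBall p E}
    (h : ∃ y : PadicAlgCl p, Valued.v y ≤ 1 ∧ (x : PadicAlgCl p) = y * (p : PadicAlgCl p) ^ t) :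
    ((p : ℕ) : unitBall p E) ^ t ∣ x := by
  obtain ⟨y, hy, hxy⟩ := h
  refine pow_prime_dvd_of_valued_le p E t ?_
  rw [hxy, map_mul]
  calc Valued.v y * Valued.v ((p : PadicAlgCl p) ^ t) ≤ 1 * Valued.v ((p : PadicAlgCl p) ^ t) := by
        gcongr
    _ = _ := one_mul _

/-! ### Over a smaller unit ball -/

variable (E₀ : IntermediateField ℚ_[p] (PadicAlgCl p))

omit [FiniteDimensional ℚ_[p] E] in
/-- `𝒪_{E₀} ≤ 𝒪_E` for `E₀ ≤ E`. [folklore] -/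
theorem unitBall_mono (hle : E₀ ≤ E) : unitBall p E₀ ≤ unitBall p E := fun _ hx =>
  (mem_unitBall_iff p E).2 ⟨hle ((mem_unitBall_iff p E₀).1 hx).1, ((mem_unitBall_iff p E₀).1 hx).2⟩

/-- **`𝒪_E` is a finitely generated `𝒪_{E₀}`-module** (for the algebra structure of the inclusion
`𝒪_{E₀} ≤ 𝒪_E`), being finitely generated over `ℤ_p`. [cite: NeukirchANT1999, Ch. II (6.8)] -/
theorem moduleFinite_unitBall_of_le (hle : E₀ ≤ E) :
    letI := (Subring.inclusion (unitBall_mono p E E₀ hle)).toAlgebra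
    Module.Finite (unitBall p E₀) (unitBall p E) := by
  letI := (Subring.inclusion (unitBall_mono p E E₀ hle)).toAlgebra
  haveI : IsScalarTower ℤ_[p] (unitBall p E₀) (unitBall p E) :=
    IsScalarTower.of_algebraMap_eq fun _ => rfl
  exact Module.Finite.of_restrictScalars_finite ℤ_[p] (unitBall p E₀) (unitBall p E)

/-- **`𝒪_E` is a free `𝒪_{E₀}`-module** (finitely generated and torsion-free over the principal
ideal domain `𝒪_{E₀}`). [cite: NeukirchANT1999, Ch. II (6.8)] -/
theorem moduleFree_unitBall_of_le [FiniteDimensional ℚ_[p] E₀] (hle : E₀ ≤ E) :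
    letI := (Subring.inclusion (unitBall_mono p E E₀ hle)).toAlgebra
    Module.Free (unitBall p E₀) (unitBall p E) := by
  letI := (Subring.inclusion (unitBall_mono p E E₀ hle)).toAlgebra
  haveI := moduleFinite_unitBall_of_le p E E₀ hle
  haveI : FaithfulSMul (unitBall p E₀) (unitBall p E) :=
    (faithfulSMul_iff_algebraMap_injective _ _).2 (Subring.inclusion_injective _)
  haveI : Module.IsTorsionFree (unitBall p E₀) (unitBall p E) := inferInstance
  exact Module.free_of_finite_type_torsion_free'

end PadicIntermediateField

end Literature.NumberTheory.Automorphic
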